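import Mathlib
import Literature.Combinatorics.SetFamily.AhlswedeDaykinDifferences
import Summits.CriticalPhenomena.PercolationContinuityZ3.Theorems.PercNearOneGluingNoHeavyLowerTailHexMSMatchBlockCount

/-!
# (MS2) when few second differences are old — block counting plus Ahlswede–Daykin (hp-7 gen 78)

Support file for crux `stmt-CriticalPhenomena-4575` (route `PercNearOneGluingNoHeavy`), hull-port seat `prim-hp-7` (generation 78);
`--supports stmt-CriticalPhenomena-4575 --as helper`.  No `sorry`.  Memo: `run/shared/lean/prim/prim-hp-7/FROM-prim-hp-7-g78-RECTANGLES-AND-REDUCTIONS.md` §7.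

`BlockCount.ms2_of_blockCount` (rank `Q` before `P`) asks for `#(D₅ ∪ D₂) ≤ #(C₅ ∪ SD_new)`.  Since `D₅ ⊆ C₅` for admissible instances and the
Ahlswede–Daykin difference theorem (tree: `Literature.Combinatorics.SetFamily.card_le_card_diffs_of_forall_exists_sdiff_subset`) gives `#D₂ ≤ #(Q \\ D₂)`
(every `d ∈ D₂` lies inside a member of `Q`), the criterion holds as soon as the OLD type-2 second differences (those `q \ d` that are differences of
members) are outnumbered by the spare one-way cross differences `C₅ \ D₅` together with the new type-5 second differences that are not type-2 second
differences.  With a common element there are no old second differences at all, so this contains the mirror form of `CommonElement.ms2_of_common_element`.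

* `BlockCount.ms2_of_card_old_le` — no `q ⊆ p` and `#D₅ + #((Q \\ D₂) ∩ (F \\ F)) ≤ #C₅ + #((P \\ D₅) \ (F \\ F ∪ Q \\ D₂))` ⟹ (MS2)
  (for admissible instances `D₅ ⊆ C₅`, so the hypothesis says: old type-2 second differences ≤ spare one-way cross differences + exclusive new type-5 ones).
-/

namespace Summit.CriticalPhenomena.PercolationContinuityZ3.Theorems

namespace BlockCount

open Finset
open scoped FinsetFamily

variable {α : Type*} [DecidableEq α]

/-- **(MS2) when the old type-2 second differences are few** (hp-7 gen 78): block counting (`Q` before `P`) with the count of type-2 second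
differences supplied by the Ahlswede–Daykin difference theorem. -/
theorem ms2_of_card_old_le (P Q D₅ D₂ : Finset (Finset α)) (hPQ : Disjoint P Q)
    (hD₅ : D₅ ⊆ P \\ Q) (hD₂ : D₂ ⊆ Q \\ P)
    (hcont : ∀ q ∈ Q, ∀ p ∈ P, ¬ q ⊆ p)
    (hcount : #D₅ + #((Q \\ D₂) ∩ ((P ∪ Q) \\ (P ∪ Q))) ≤
      #((P \\ Q) \ ((Q \\ P) ∪ (P \\ P) ∪ (Q \\ Q))) + #((P \\ D₅) \ (((P ∪ Q) \\ (P ∪ Q)) ∪ (Q \\ D₂)))) :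
    #((P ∪ Q) ∪ D₅ ∪ D₂) ≤ #(((P ∪ Q) \\ (P ∪ Q)) ∪ (P \\ D₅) ∪ (Q \\ D₂)) := by
  classical
  set ΔF : Finset (Finset α) := (P ∪ Q) \\ (P ∪ Q) with hΔF
  set C₅ : Finset (Finset α) := (P \\ Q) \ ((Q \\ P) ∪ (P \\ P) ∪ (Q \\ Q)) with hC₅def
  set SDnew : Finset (Finset α) := ((P \\ D₅) ∪ (Q \\ D₂)) \ ΔF with hSDnew
  -- Ahlswede–Daykin: the type-2 second differences are at least as numerous as `D₂`
  have hAD : #D₂ ≤ #(Q \\ D₂) := by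
    refine Literature.Combinatorics.SetFamily.card_le_card_diffs_of_forall_exists_sdiff_subset Q D₂ ?_
    intro B₁ hB₁ B₂ _
    obtain ⟨q, hq, p, -, rfl⟩ := mem_diffs.mp (hD₂ hB₁)
    exact ⟨q, hq, sdiff_subset.trans sdiff_subset⟩
  -- split the type-2 second differences into old and new
  have hsplit : #(Q \\ D₂) = #((Q \\ D₂) ∩ ΔF) + #((Q \\ D₂) \ ΔF) := by
    have h := card_filter_add_card_filter_not (s := Q \\ D₂) (fun t => t ∈ ΔF)
    have e1 : (Q \\ D₂).filter (fun t => t ∈ ΔF) = (Q \\ D₂) ∩ ΔF := by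
      ext t; simp only [mem_filter, mem_inter]
    have e2 : (Q \\ D₂).filter (fun t => ¬ t ∈ ΔF) = (Q \\ D₂) \ ΔF := by
      ext t; simp only [mem_filter, mem_sdiff]
    rw [e1, e2] at h
    exact h.symm
  -- the two new families are disjoint parts of `SDnew`
  have hnew : #((P \\ D₅) \ (ΔF ∪ (Q \\ D₂))) + #((Q \\ D₂) \ ΔF) ≤ #SDnew := by
    rw [← card_union_of_disjoint]
    · apply card_le_card
      intro t ht
      rcases mem_union.mp ht with ht | ht
      · obtain ⟨h1, h2⟩ := mem_sdiff.mp ht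
        exact mem_sdiff.mpr ⟨mem_union_left _ h1, fun h => h2 (mem_union_left _ h)⟩
      · obtain ⟨h1, h2⟩ := mem_sdiff.mp ht
        exact mem_sdiff.mpr ⟨mem_union_right _ h1, h2⟩
    · rw [Finset.disjoint_left]
      intro t ht ht'
      exact (mem_sdiff.mp ht).2 (mem_union_right _ (mem_sdiff.mp ht').1)
  -- `C₅ ⊆ ΔF` is disjoint from `SDnew`
  have hdisj : Disjoint C₅ SDnew := by
    rw [Finset.disjoint_left]
    intro t ht ht'
    obtain ⟨htPQ, -⟩ := mem_sdiff.mp ht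
    obtain ⟨p, hp, q, hq, rfl⟩ := mem_diffs.mp htPQ
    exact (mem_sdiff.mp ht').2 (mem_diffs.mpr ⟨p, mem_union_left _ hp, q, mem_union_right _ hq, rfl⟩)
  refine ms2_of_blockCount P Q D₅ D₂ hPQ hD₅ hD₂ hcont ?_
  change #(D₅ ∪ D₂) ≤ #(C₅ ∪ SDnew)
  rw [card_union_of_disjoint hdisj]
  calc #(D₅ ∪ D₂) ≤ #D₅ + #D₂ := card_union_le _ _
    _ ≤ #D₅ + #(Q \\ D₂) := by omega
    _ = #D₅ + #((Q \\ D₂) ∩ ΔF) + #((Q \\ D₂) \ ΔF) := by rw [hsplit, add_assoc]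
    _ ≤ #C₅ + #((P \\ D₅) \ (ΔF ∪ (Q \\ D₂))) + #((Q \\ D₂) \ ΔF) := by omega
    _ ≤ #C₅ + #SDnew := by omega


/-! ### Appended (hp-7 gen 80): the mirror form (rank `P` before `Q`, Ahlswede–Daykin pays for `D₅`) -/

/-- The mirror form of `ms2_of_card_old_le` (hp-7 gen 80): no `p ⊆ q` and
`#D₂ + #((P \\ D₅) ∩ (F \\ F)) ≤ #C₂ + #((Q \\ D₂) \ (F \\ F ∪ P \\ D₅))` (`C₂` the one-way pure cross differences `q \ p`) ⟹ (MS2). -/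
theorem ms2_of_card_old_le' (P Q D₅ D₂ : Finset (Finset α)) (hPQ : Disjoint P Q)
    (hD₅ : D₅ ⊆ P \\ Q) (hD₂ : D₂ ⊆ Q \\ P)
    (hcont : ∀ p ∈ P, ∀ q ∈ Q, ¬ p ⊆ q)
    (hcount : #D₂ + #((P \\ D₅) ∩ ((P ∪ Q) \\ (P ∪ Q))) ≤
      #((Q \\ P) \ ((P \\ Q) ∪ (Q \\ Q) ∪ (P \\ P))) + #((Q \\ D₂) \ (((P ∪ Q) \\ (P ∪ Q)) ∪ (P \\ D₅)))) :
    #((P ∪ Q) ∪ D₅ ∪ D₂) ≤ #(((P ∪ Q) \\ (P ∪ Q)) ∪ (P \\ D₅) ∪ (Q \\ D₂)) := by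
  classical
  have hcount' : #D₂ + #((P \\ D₅) ∩ ((Q ∪ P) \\ (Q ∪ P))) ≤
      #((Q \\ P) \ ((P \\ Q) ∪ (Q \\ Q) ∪ (P \\ P))) + #((Q \\ D₂) \ (((Q ∪ P) \\ (Q ∪ P)) ∪ (P \\ D₅))) := by
    rw [union_comm Q P]; exact hcount
  have h := ms2_of_card_old_le Q P D₂ D₅ hPQ.symm hD₂ hD₅ hcont hcount'
  have e1 : (Q ∪ P) ∪ D₂ ∪ D₅ = (P ∪ Q) ∪ D₅ ∪ D₂ := by
    rw [union_comm Q P, union_assoc, union_comm D₂ D₅, ← union_assoc]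
  have e2 : ((Q ∪ P) \\ (Q ∪ P)) ∪ (Q \\ D₂) ∪ (P \\ D₅) = ((P ∪ Q) \\ (P ∪ Q)) ∪ (P \\ D₅) ∪ (Q \\ D₂) := by
    rw [union_comm Q P, union_assoc, union_comm (Q \\ D₂) (P \\ D₅), ← union_assoc]
  rw [e1, e2] at h
  exact h

end BlockCount

end Summit.CriticalPhenomena.PercolationContinuityZ3.Theorems
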